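import Literature.NumberTheory.EllipticCurves.DivisionValuesSigmaFormulaProofs
import HarnessLib

/-!
# The division value `ωₙ` in terms of `ψ`'s and `φₙ`: `2 ωₙ ψₙ = ψ₂ₙ − a₁ φₙ ψₙ² − a₃ ψₙ⁴` (proofs only)

Topic `NumberTheory/EllipticCurves`; proofs-only companion of `DivisionPolynomialMultiplication`
(the universal `ωₙ ∈ ℤ[A₁, A₂, A₃, A₄, X, Y]`, `UnivEC.ω`, defined there by integrality as the numerator
of `y ∘ [n]`) and of `DivisionValuesSigmaFormulaProofs` (the sigma formula for `⟨nP, nP⟩` in the integer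
division values `φₙ(P), ψₙ(P), ωₙ(P)`). Silverman's Exercise 3.7 gives `ωₙ` in closed form only for
`a₁ = a₃ = 0` (`4y ωₙ = ψₙ₊₂ψₙ₋₁² − ψₙ₋₂ψₙ₊₁²`); for a general Weierstrass equation the `y`-coordinate of
`[n]P = (φₙ/ψₙ², ωₙ/ψₙ³)` satisfies `2y([n]P) + a₁x([n]P) + a₃ = ψ₂ₙ(P)/ψₙ(P)⁴` (the value of
`ψ₂ = 2y + a₁x + a₃` at `[n]P`, Exercise 3.7(d) applied to `n` and `2n`), i.e. the polynomial identity

  `2 ωₙ ψₙ = ψ₂ₙ − A₁ φₙ ψₙ² − A₃ ψₙ⁴`  in `ℤ[A₁, A₂, A₃, A₄, X, Y]`,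

which makes `ωₙ(P)` COMPUTABLE from the `ψ`'s (this is how the tree's `UnivEC.Yn`, `UnivEC.Tn` are set
up; here it is exported as an identity of `U` and specialised to points). Used by the valuation-class
line at `p = 3` (crux `SchneiderOnDoorSubfamily`) to evaluate `u_Q = −ωₙ/φₙ` and `t_Q = −φₙψₙ/ωₙ`
modulo `9` as polynomials in the parameters.

## Contents
* `UnivEC.two_mul_ω_mul_ψ` — the identity in `U`; `UnivEC.two_mul_ω_two` — `n = 2`:
  `2 ω₂ = preΨ₄(X) − A₁ φ₂ ψ₂ − A₃ ψ₂³` (`ψ₄ = preΨ₄ · ψ₂`).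
* `WeierstrassCurve.two_mul_ev_ω_mul_evalEval_ψ` — at a point `(x₀, y₀)` of any Weierstrass curve `W/S`:
  `2 ωₙ(x₀,y₀) ψₙ(x₀,y₀) = ψ₂ₙ(x₀,y₀) − a₁ φₙ ψₙ² − a₃ ψₙ⁴`; `…_two` for `n = 2`.

## References
* [SilvermanAEC2009] J. H. Silverman, *The Arithmetic of Elliptic Curves*, 2nd ed., Exercise 3.7(d)
  (`[n]P = (φₙ/ψₙ², ωₙ/ψₙ³)`), III.2.3 (negation `−(x, y) = (x, −y − a₁x − a₃)`).
-/

noncomputable section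

open Polynomial WeierstrassCurve

namespace Literature.NumberTheory.EllipticCurves.UnivEC

/-- **`2 ωₙ ψₙ = ψ₂ₙ − A₁ φₙ ψₙ² − A₃ ψₙ⁴` in `ℤ[A₁, A₂, A₃, A₄, X, Y]`**: the `y`-coordinate
`ωₙ/ψₙ³` of `[n]P` and its negative `−ωₙ/ψₙ³ − A₁φₙ/ψₙ² − A₃` differ by `ψ₂([n]P) = ψ₂ₙ/ψₙ⁴`
(`UnivEC.Yn_sub_negY`, `UnivEC.ι_ω`); for `n = 0` both sides vanish. [cite: SilvermanAEC2009, Exercise 3.7(d)] -/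
theorem two_mul_ω_mul_ψ (n : ℤ) : 2 * ω n * ψ n = ψ (2 * n) - A₁ * φ n * ψ n ^ 2 - A₃ * ψ n ^ 4 := by
  rcases eq_or_ne n 0 with rfl | hn
  · simp [UnivEC.ψ, WeierstrassCurve.ψ_zero]
  apply ι_injective
  have hψ : ι (ψ n) ≠ 0 := ιψ_ne_zero hn
  have key := Yn_sub_negY n
  rw [WeierstrassCurve.Affine.negY, Yn, Tn, Xn] at key
  simp only [WeierstrassCurve.map_a₁, WeierstrassCurve.map_a₃, curve_a₁, curve_a₃] at key
  simp only [map_mul, map_sub, map_pow, map_ofNat, ι_ω hn, Yn, Tn, Xn]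
  field_simp

/-- **`n = 2`: `2 ω₂ = preΨ₄(X) − A₁ φ₂ ψ₂ − A₃ ψ₂³`** (cancel `ψ₂ ≠ 0` in `ψ₄ = preΨ₄ · ψ₂`).
[cite: SilvermanAEC2009, Exercise 3.7(d)] -/
theorem two_mul_ω_two : 2 * ω 2 = curve.preΨ₄.eval xU - A₁ * φ 2 * ψ 2 - A₃ * ψ 2 ^ 3 := by
  have h := two_mul_ω_mul_ψ 2
  have h4 : ψ (2 * 2) = curve.preΨ₄.eval xU * ψ 2 := by
    rw [show (2 * 2 : ℤ) = 4 from rfl, UnivEC.ψ, UnivEC.ψ, WeierstrassCurve.ψ_four, evalEval_mul,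
      evalEval_C, WeierstrassCurve.ψ_two]
  rw [h4] at h
  have hψ : ψ 2 ≠ 0 := ψ_ne_zero two_ne_zero
  have : (2 * ω 2 - (curve.preΨ₄.eval xU - A₁ * φ 2 * ψ 2 - A₃ * ψ 2 ^ 3)) * ψ 2 = 0 := by
    linear_combination h
  rcases mul_eq_zero.mp this with h0 | h0
  · exact sub_eq_zero.mp h0
  · exact absurd h0 hψ

end Literature.NumberTheory.EllipticCurves.UnivEC

namespace WeierstrassCurve

open Literature.NumberTheory.EllipticCurves

variable {S : Type*} [CommRing S] (W : WeierstrassCurve S) {x₀ y₀ : S}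

/-- **At a point of any Weierstrass curve**: for `(x₀, y₀)` on `W/S` and every `n`,
`2 ωₙ(x₀,y₀) ψₙ(x₀,y₀) = ψ₂ₙ(x₀,y₀) − a₁ φₙ(x₀,y₀) ψₙ(x₀,y₀)² − a₃ ψₙ(x₀,y₀)⁴`, where
`ωₙ(x₀,y₀) = UnivEC.ev W x₀ y₀ (UnivEC.ω n)` and `φₙ, ψₙ` are Mathlib's. So `ωₙ(P)` is determined by the
`ψ`'s whenever `2ψₙ(P)` is a non-zero-divisor (e.g. over `ℤ` with `ψₙ(P) ≠ 0`). [cite: SilvermanAEC2009, Exercise 3.7(d)] -/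
theorem two_mul_ev_ω_mul_evalEval_ψ (h : W.toAffine.Equation x₀ y₀) (n : ℤ) :
    2 * UnivEC.ev W x₀ y₀ (UnivEC.ω n) * (W.ψ n).evalEval x₀ y₀ =
      (W.ψ (2 * n)).evalEval x₀ y₀ - W.a₁ * (W.φ n).evalEval x₀ y₀ * (W.ψ n).evalEval x₀ y₀ ^ 2 -
        W.a₃ * (W.ψ n).evalEval x₀ y₀ ^ 4 := by
  have key := congrArg (UnivEC.ev W x₀ y₀) (UnivEC.two_mul_ω_mul_ψ n)
  simp only [map_mul, map_sub, map_pow, map_ofNat, UnivEC.ev_A₁, UnivEC.ev_A₃, UnivEC.map_ψ,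
    UnivEC.map_φ, UnivEC.curve_map_ev h, UnivEC.ev_xU, UnivEC.ev_yU] at key
  exact key

/-- **`n = 2` at a point**: `2 ω₂(x₀,y₀) = preΨ₄(x₀) − a₁ φ₂(x₀,y₀) ψ₂(x₀,y₀) − a₃ ψ₂(x₀,y₀)³`, with
`ψ₂(x₀,y₀) = 2y₀ + a₁x₀ + a₃`, `φ₂ = x ψ₂² − Ψ₃`. [cite: SilvermanAEC2009, Exercise 3.7(d)] -/
theorem two_mul_ev_ω_two (h : W.toAffine.Equation x₀ y₀) :
    2 * UnivEC.ev W x₀ y₀ (UnivEC.ω 2) =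
      W.preΨ₄.eval x₀ - W.a₁ * (W.φ 2).evalEval x₀ y₀ * (W.ψ 2).evalEval x₀ y₀ -
        W.a₃ * (W.ψ 2).evalEval x₀ y₀ ^ 3 := by
  have key := congrArg (UnivEC.ev W x₀ y₀) UnivEC.two_mul_ω_two
  simp only [map_mul, map_sub, map_pow, map_ofNat, UnivEC.ev_A₁, UnivEC.ev_A₃, UnivEC.map_ψ,
    UnivEC.map_φ, UnivEC.curve_map_ev h, UnivEC.ev_xU, UnivEC.ev_yU] at key
  rw [key, ← Polynomial.eval₂_at_apply, ← Polynomial.eval_map, ← WeierstrassCurve.map_preΨ₄,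
    UnivEC.curve_map_ev h, UnivEC.ev_xU]

end WeierstrassCurve

end
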